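import Summits.QuantumFields.YangMills.Theorems.LangevinControlUVOSLegsAtWeakCouplingCDefs
import Summits.QuantumFields.YangMills.Theorems.HypercubicLimit.Negative.TruncatedOSForm
import HarnessLib

/-!
# Crux `OSLegsAtWeakCouplingC` (stmt-QuantumFields-16207), line `Sketch`: the NT leg is NECESSARY

Support file (continuation lead c5).  The line closes the crux modulo two hypothesis-side imports, E0′
(`MomentBounds6`) and NT (`LowerBounds` — k-free lower bounds for the smeared truncated two- and three-point functions of
the action density on LARGE tori), plus an E1 input.  This file records, on the tree's OS-reconstruction side, that an
NT-type statement is not an artefact of the line but part of the CONTENT of the crux's conclusion: `ConclC G r a`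
itself asserts non-triviality of lattice Yang–Mills on the witnessing scheme's OWN tori — which have `a_k L_k → ∞`
(`SpeciesScheme.tendsto_L`), i.e. are eventually larger than every femto torus `L a ≤ ℓ₀` on which the crux
hypotheses H1/H2 speak — in exactly the reflection-diagonal lattice form that `LowerBounds` (i) postulates (up to the
witness's renormalisation, which `latticeSchwinger` carries).

* `conclC_imp_latticeNontrivial` — `ConclC G r a` ⇒ there are a scheme `sch` in units `a` with `β_k → ∞` and a uniform
  lattice gap, and ONE real positive-time test function `v`, such that the renormalised, smeared, truncated
  reflection-diagonal lattice two-point function of the curvature `⟨Φ_k(θv)Φ_k(v)⟩ − ⟨Φ_k(θv)⟩⟨Φ_k(v)⟩` converges to a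
  strictly POSITIVE number along `sch` — whose tori eventually exceed any prescribed physical size;
* `osLegsAtWeakCouplingC_imp_latticeNontrivial` — the same read off the crux BY NAME, at every `(G, r, a)` carrying
  its hypotheses.

Mechanism: the landed `HypercubicLimit.Negative.twoPointNontrivial_iff_lattice_diagonal` (OS reconstruction without E1:
E2 + translations + `𝔖₀ = 1`, all supplied by `OSData`; the convergence clause is `IsYangMillsFor`).
Refs: OsterwalderSchrader1973 §4.1; GlimmJaffe1987 Thm. 6.1.3; JaffeWitten2000 §6.
-/

set_option autoImplicit false

noncomputable section

open scoped SchwartzMap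
open MeasureTheory Filter Topology
open Literature.MathematicalPhysics.QuantumFieldTheory Literature.MathematicalPhysics.QuantumLattice
open Literature.MathematicalPhysics.AQFT
open Summit.QuantumFields.YangMills.Theses.LangevinControlUV (OSLegsAtWeakCouplingC)
open Summit.QuantumFields.YangMills.Cruxes.OSLegsFromFemtoAndGap.DlrCollarTransfer (TwoPoint Skewness GapInUnits)
open Summit.QuantumFields.YangMills.Theorems.HypercubicLimit.Negative (twoPointNontrivial_iff_lattice_diagonal)

namespace Summit.QuantumFields.YangMills.Cruxes.OSLegsAtWeakCouplingC.Sketch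

variable {G : Type} [Group G] [TopologicalSpace G] [IsTopologicalGroup G] [CompactSpace G]
  [MeasurableSpace G] [BorelSpace G]

/-- **NT is necessary: the crux's conclusion asserts large-torus non-triviality in lattice form.**  If `ConclC G r a`
holds then along some scheme in units `a` with `β_k → +∞`, a uniform lattice gap, and tori of physical size
`a_k (2L_k+1)` eventually exceeding every bound, the renormalised smeared truncated reflection-diagonal lattice two-point
function of the curvature converges, for one real positive-time `v`, to some `ℓ > 0`. -/
theorem conclC_imp_latticeNontrivial (r : LatticeRep G) (a : ℝ → ℝ) (h : ConclC G r a) :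
    ∃ sch : SpeciesScheme (YMSpecies G), (∀ k, sch.a k = a (sch.β k)) ∧ sch.HasWeakCouplingLimit ∧
      (∃ Δ : ℝ, 0 < Δ ∧ HasLatticeMassGap r sch Δ) ∧
      (∀ ℓ₀ : ℝ, ∀ᶠ k in atTop, ℓ₀ < sch.a k * sch.L k) ∧
      ∃ v : 𝓢(EuclideanSpace ℝ (Fin 4), ℝ), tsupport v ⊆ {y : EuclideanSpace ℝ (Fin 4) | 0 < y 0} ∧
        ∃ ℓ : ℝ, 0 < ℓ ∧
          Tendsto (fun k : ℕ =>
            latticeSchwinger r.ρ sch (fun s => s.F) k (1 + 1) (fun _ => r.curvature) ![thetaTest 4 v, v] -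
              latticeSchwinger r.ρ sch (fun s => s.F) k 1 (fun _ => r.curvature) ![thetaTest 4 v] *
                latticeSchwinger r.ρ sch (fun s => s.F) k 1 (fun _ => r.curvature) ![v]) atTop (𝓝 ℓ) := by
  obtain ⟨sch, T, hunits, hw, hYM, hnt, -, Δ, hΔ, hlat⟩ := h
  -- OS reconstruction without rotations is available for the OS data `T`
  have hrec : OSReconstructionNoE1 T.schwinger := OSReconstructionNoE1.of_osAxioms T.osAxioms
  -- the landed lattice-diagonal criterion, read left to right
  have key := (twoPointNontrivial_iff_lattice_diagonal r sch T.schwinger hYM hrec T.normalized r.curvature).1 hnt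
  refine ⟨sch, hunits, hw, ⟨Δ, hΔ, hlat⟩, fun ℓ₀ => ?_, key⟩
  exact (sch.tendsto_L.eventually (eventually_gt_atTop ℓ₀)).mono fun k hk => hk

/-- **The crux BY NAME entails large-torus non-triviality** at every `(G, r, a)` carrying its hypotheses: whoever
proves `OSLegsAtWeakCouplingC` proves, for each compact simple `G`, each `r` and each continuous unit map with H1–H3,
non-triviality of lattice Yang–Mills in the reflection-diagonal form on tori of diverging physical size — where H1 and
H2 (femto tori only) are silent (`cruxC_iff` + `conclC_imp_latticeNontrivial`). -/
theorem osLegsAtWeakCouplingC_imp_latticeNontrivial (h : OSLegsAtWeakCouplingC) :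
    ∀ (G : Type) [Group G] [TopologicalSpace G] [IsTopologicalGroup G] [CompactSpace G],
      IsCompactSimpleLieGroup G → letI : MeasurableSpace G := borel G; haveI : BorelSpace G := ⟨rfl⟩;
      ∀ (r : LatticeRep G) (a : ℝ → ℝ), Continuous a → TwoPoint G r a → Skewness G r a → GapInUnits G r a →
        ∃ sch : SpeciesScheme (YMSpecies G), (∀ k, sch.a k = a (sch.β k)) ∧ sch.HasWeakCouplingLimit ∧
          (∃ Δ : ℝ, 0 < Δ ∧ HasLatticeMassGap r sch Δ) ∧
          (∀ ℓ₀ : ℝ, ∀ᶠ k in atTop, ℓ₀ < sch.a k * sch.L k) ∧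
          ∃ v : 𝓢(EuclideanSpace ℝ (Fin 4), ℝ), tsupport v ⊆ {y : EuclideanSpace ℝ (Fin 4) | 0 < y 0} ∧
            ∃ ℓ : ℝ, 0 < ℓ ∧
              Tendsto (fun k : ℕ =>
                latticeSchwinger r.ρ sch (fun s => s.F) k (1 + 1) (fun _ => r.curvature) ![thetaTest 4 v, v] -
                  latticeSchwinger r.ρ sch (fun s => s.F) k 1 (fun _ => r.curvature) ![thetaTest 4 v] *
                    latticeSchwinger r.ρ sch (fun s => s.F) k 1 (fun _ => r.curvature) ![v]) atTop (𝓝 ℓ) := by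
  rw [cruxC_iff] at h
  intro G _ _ _ _ hG
  letI : MeasurableSpace G := borel G
  haveI : BorelSpace G := ⟨rfl⟩
  intro r a ha h1 h2 h3
  exact conclC_imp_latticeNontrivial r a (h G hG r a ha h1 h2 h3)

end Summit.QuantumFields.YangMills.Cruxes.OSLegsAtWeakCouplingC.Sketch

end
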